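import Mathlib.Analysis.InnerProductSpace.Adjoint
import Literature.Analysis.FluidPDE.KatoLaiPeriodicCylinderProofs
import Literature.Analysis.FluidPDE.Ferrari1993Continuation
import HarnessLib

/-!
# Classical Navier–Stokes flows in a container: perfect slip / no-slip walls, and the periodic
cylinder `{r < 1} × ℝ/Lℤ`

Topic `Literature/Analysis/FluidPDE`. The viscous twin of the Euler container classes
`IsClassicalEulerOnDomain` (`AxisymmetricEuler.lean`) and `IsPeriodicCylinderEulerSolution` /
`IsCylinderEulerSolution` (`KatoLaiPeriodicCylinder.lean`, `ChenHouContinuationProofs.lean`),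
requested by route `RobustBlowupPortability` (Navier–Stokes regularity) to type the *cylinder*
analogue of its torus portability lemma for Hou's axisymmetric container.

For a viscous fluid in a rigid container `Ω` the momentum and continuity equations
`∂ₜu + (u·∇)u = −∇p + νΔu + f`, `div u = 0` (Lemarié-Rieusset 2016, §2.9, (2.20)–(2.21)) are
complemented on the wall `∂Ω` (outer unit normal `n`) by one of (Köhne 2013, Ch. 2):

* the **no-slip** condition `u = 0` (Köhne (2.7); Lemarié-Rieusset §2.9) — the condition of
  Hou 2022, §2, for the axisymmetric Navier–Stokes computation in the cylinder `{r ≤ 1}`,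
  `z`-periodic: "the velocity satisfies a no-slip no-flow boundary condition on the solid
  boundary `r = 1`", `ψ₁(t,1,z) = 0`, `u^θ(t,1,z) = u^z(t,1,z) = 0`;
* the **perfect (free, pure, total) slip** condition `u · n = 0`, `P_∂Ω (S n) = 0`, `S = 2νε − p`
  the Cauchy stress, `ε = ½(Du + (Du)ᵀ)` the strain tensor, `P_∂Ω` the tangential projection
  (Köhne (2.8); the case `λ → ∞` of the Navier condition (2.6)
  `u · n = 0`, `P_∂Ω u + λ P_∂Ω (S n) = 0`); since `P_∂Ω (S n) = 2ν P_∂Ω (ε n)` (Köhne, 2.19) it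
  reads, for `ν > 0`, `u · n = 0` and `τ · ε n = 0` for every tangent vector `τ`
  (Lemarié-Rieusset 2016, §2.9, eq. (2.27), "pure slip"; Solonnikov–Ščadilov 1973).

## Main definitions

* `strainRateWithin v K x : E →L[ℝ] E` — the strain (rate-of-deformation) tensor
  `ε = ½(Dv + (Dv)ᵀ)` (Lemarié-Rieusset (2.12)) built from the derivative of `v` **within** `K`
  at `x` (take `K = closure Ω` to differentiate up to the wall, `K = univ` in the whole space).
* `IsClassicalNSOnDomain S Ω ν f u p` — `u`, `p` are `C^∞` on `S × closure Ω` jointly in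
  `(t, x)` and solve the forced Navier–Stokes system at the interior points, on the time set `S`
  (one-sided time derivative `timeDerivWithin S`, as in all classical-solution classes here).
* `IsClassicalPerfectSlipNSOnDomain S Ω n ν f u p` — … with `u · n = 0` and `τ · ε(u) n = 0`
  (`τ ⟂ n`) on `S × frontier Ω`, `ε(u) = strainRateWithin (u t) (closure Ω) x`.
* `IsClassicalNoSlipNSOnDomain S Ω ν f u p` — … with `u = 0` on `S × frontier Ω`.
* `IsSlipCylinderClassicalNSSolutionOn L S ν f u p` — **the requested notion**: perfect slip in
  the cylinder `unitCylinder = {r < 1}` (normal `eR`), fields on `ℝ³`, velocity and pressure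
  `L`-periodic in `z` (the periodic cylinder `{r ≤ 1} × ℝ/Lℤ` of Hou 2022 §2 / Chen–Hou, as in
  the Euler twin `IsPeriodicCylinderEulerSolution`, here forced and viscous).
* `IsNoSlipCylinderClassicalNSSolutionOn L S ν f u p` — the same container with the no-slip
  wall (literally Hou 2022, §2).

## Main statements (all proved, [folklore])

* `inner_strainRateWithin`, `strainRateWithin_comm`, `strainRateWithin_of_mem_nhds`;
* restriction of the time set (`….mono`) and time translation (`….comp_add_right`) for all
  classes;
* `IsClassicalPerfectSlipNSOnDomain.inner_strainRate_normal_velocity`,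
  `….inner_cauchyStress_normal_velocity`: on the wall the power density of the Cauchy stress
  `⟪(2ν ε(u) − p) n, u⟫` vanishes — the boundary term of the energy balance
  (Köhne 2013, 2.15–2.16, (2.13a)) is zero under perfect slip;
* `IsClassicalNoSlipNSOnDomain.noPenetration`;
* `IsSlipCylinderClassicalNSSolutionOn.conj_rotZ`: covariance of the slip-cylinder class under
  the rotations `R_θ` about the axis (so that, with a uniqueness theorem, axisymmetry of the data
  propagates exactly as in `IsPeriodicCylinderEulerSolution.rotZ_velocity_eq`).

## Faithfulness / design notes / what is NOT here

* Initial data are not part of the classes (add `u 0 = u₀`), as for `IsClassicalNSSolutionOn`.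
* The tangential wall condition is the kinematic `τ · ε(u) n = 0` of Lemarié-Rieusset (2.27),
  without the factor `2ν` of Köhne's `P_∂Ω (S n) = 0`: identical for `ν ≠ 0`, while for `ν = 0`
  the printed stress condition is void and ours is not — the classes are meant for `ν > 0`.
* Derivatives on the wall are derivatives within `closure Ω` of the time slice (the fields are
  `C^∞` up to the boundary; `closure {r < 1} = {r ≤ 1}` is a set of unique differentiability,
  `uniqueDiffOn_closure_unitCylinder`); at interior points they are the Fréchet derivatives
  (`strainRateWithin_of_mem_nhds`). Values of `u`, `p`, `f` outside `S × closure Ω` are not seen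
  (except through the global periodicity clause, as in the Euler twin).
* No regularity is imposed on `f` (it is determined on `S × Ω` by the equation), and `f` is not
  asked to be periodic (it is, on `S × Ω`, when `u` and `p` are).
* Not here: the energy identity itself (integration by parts on a period cell of the cylinder,
  cf. `KatoLaiPeriodicCylinderProofs.lean` for the Euler case), existence/uniqueness/regularity
  for the Navier-slip problem, the vorticity form `ω × n = 0` of the slip condition
  (Lemarié-Rieusset (2.28), equivalent to (2.27) only on flat walls).

Tree/Mathlib search: `lean search 'strain|deformation|NoSlip|OnDomain|symGrad'` — only the torus
`symGrad` of `NSRPerturbation.lean` (Fourier side) and the Euler class `IsClassicalEulerOnDomain`;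
Mathlib has no Navier–Stokes notions. Used: `ContinuousLinearMap.adjoint`, `fderivWithin`,
`ContinuousLinearEquiv.comp_fderivWithin` / `comp_right_fderivWithin`, and from the tree
`timeDerivWithin_eq_of_subset_of_contDiffOn`, `timeDerivWithin_comp_add_right`,
`contDiffOn_uncurry_comp_rotZ`, `timeDerivWithin_rotZ_conj`, `eR_rotZ`, the isometry lemmas of
`IsometryInvariance.lean`.

## References

* P. G. Lemarié-Rieusset, *The Navier–Stokes Problem in the 21st Century* (CRC 2016), §2.6
  eq. (2.12) (strain tensor), §2.9 eqs. (2.20)–(2.21), (2.27) (pure slip), (2.28).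
* M. Köhne, *Lp-Theory for Incompressible Newtonian Flows* (Springer Spektrum 2013), Ch. 2,
  eqs. (2.4), (2.6)–(2.8), paragraphs 2.15–2.19 (energy balance and the boundary power).
* T. Y. Hou, *Potentially singular behavior of the 3D Navier–Stokes equations*, Found. Comput.
  Math. 23 (2023) = arXiv:2107.06509, §2 (the periodic cylinder, no-slip no-flow wall).
-/

noncomputable section

open Set Function Filter TopologicalSpace
open scoped ContDiff Laplacian InnerProductSpace RealInnerProductSpace Topology

namespace Literature.Analysis.FluidPDE

/-! ### The strain tensor within a set -/

section Strain

variable {E : Type*} [NormedAddCommGroup E] [InnerProductSpace ℝ E] [CompleteSpace E]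

/-- **Cauchy's strain (rate-of-deformation) tensor** `ε = ½ (Dv + (Dv)ᵀ)` of a velocity field
`v` at `x` (Lemarié-Rieusset 2016, §2.6, eq. (2.12); Köhne 2013, Introduction,
`D = ½(∇u + ∇uᵀ)`), formed with the derivative of `v` *within* the set `K` (`fderivWithin`) and
its Hilbert-space adjoint, so that for `K = closure Ω` it is the strain up to the wall of a field
differentiable up to the boundary, and for `K = univ` (or at interior points of `K`,
`strainRateWithin_of_mem_nhds`) the usual one. [cite: LemarieRieusset2016, §2.6 eq. (2.12)] -/
def strainRateWithin (v : E → E) (K : Set E) (x : E) : E →L[ℝ] E :=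
  (2⁻¹ : ℝ) • (fderivWithin ℝ v K x + ContinuousLinearMap.adjoint (fderivWithin ℝ v K x))

/-- Unfolding `strainRateWithin` on a vector. [folklore] -/
theorem strainRateWithin_apply (v : E → E) (K : Set E) (x a : E) :
    strainRateWithin v K x a =
      (2⁻¹ : ℝ) • (fderivWithin ℝ v K x a + ContinuousLinearMap.adjoint (fderivWithin ℝ v K x) a) :=
  rfl

/-- The strain tensor as a bilinear form: `⟪ε a, b⟫ = ½ (⟪Dv a, b⟫ + ⟪a, Dv b⟫)`, i.e.
`ε_{ij} = ½ (∂ᵢvⱼ + ∂ⱼvᵢ)` (Lemarié-Rieusset 2016, (2.13)). [cite: LemarieRieusset2016, §2.6 eq. (2.13)] -/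
theorem inner_strainRateWithin (v : E → E) (K : Set E) (x a b : E) :
    ⟪strainRateWithin v K x a, b⟫ = 2⁻¹ * (⟪fderivWithin ℝ v K x a, b⟫ + ⟪a, fderivWithin ℝ v K x b⟫) := by
  rw [strainRateWithin_apply, real_inner_smul_left, inner_add_left,
    ContinuousLinearMap.adjoint_inner_left]

/-- The strain tensor is symmetric: `⟪ε a, b⟫ = ⟪a, ε b⟫`. [folklore] -/
theorem strainRateWithin_comm (v : E → E) (K : Set E) (x a b : E) :
    ⟪strainRateWithin v K x a, b⟫ = ⟪a, strainRateWithin v K x b⟫ := by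
  rw [real_inner_comm (strainRateWithin v K x b) a, inner_strainRateWithin, inner_strainRateWithin,
    real_inner_comm (fderivWithin ℝ v K x b) a, real_inner_comm (fderivWithin ℝ v K x a) b]
  ring

/-- At a point where `K` is a neighbourhood (an interior point of the container) the strain
within `K` is the strain in the whole space. [folklore] -/
theorem strainRateWithin_of_mem_nhds {v : E → E} {K : Set E} {x : E} (h : K ∈ 𝓝 x) :
    strainRateWithin v K x = strainRateWithin v univ x := by
  simp only [strainRateWithin, fderivWithin_of_mem_nhds h, fderivWithin_univ]

end Strain

/-! ### Classical Navier–Stokes flows in a container -/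

section Domain

variable {E : Type*} [NormedAddCommGroup E] [InnerProductSpace ℝ E] [FiniteDimensional ℝ E]

/-- **Smooth classical solutions of the forced Navier–Stokes system in a container**, without a
wall condition: on the time set `S`, `u` and `p` are `C^∞` on `S × closure Ω` jointly in
`(t, x)` and `∂ₜu + (u·∇)u = νΔu − ∇p + f`, `div u = 0` hold at the interior points `x ∈ Ω`
(Lemarié-Rieusset 2016, §2.9, (2.20)–(2.21); the one-sided time derivative `timeDerivWithin S`
and the field shapes of `IsClassicalNSSolutionOn` / `IsClassicalEulerOnDomain`). The wall
conditions are added by `IsClassicalPerfectSlipNSOnDomain` and `IsClassicalNoSlipNSOnDomain`.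
[cite: LemarieRieusset2016, §2.9 eqs. (2.20)–(2.21)] -/
structure IsClassicalNSOnDomain (S : Set ℝ) (Ω : Opens E) (ν : ℝ) (f u : ℝ → E → E)
    (p : ℝ → E → ℝ) : Prop where
  /-- The velocity is `C^∞` on `S × closure Ω` (up to the wall), jointly in `(t, x)`. -/
  smooth_velocity : ContDiffOn ℝ ∞ (uncurry u) (S ×ˢ closure (Ω : Set E))
  /-- The pressure is `C^∞` on `S × closure Ω` (up to the wall), jointly in `(t, x)`. -/
  smooth_pressure : ContDiffOn ℝ ∞ (uncurry p) (S ×ˢ closure (Ω : Set E))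
  /-- The momentum equation `∂ₜu + (u·∇)u = νΔu − ∇p + f` in `S × Ω` (LR16 (2.20)). -/
  momentum : ∀ t ∈ S, ∀ x ∈ Ω,
    timeDerivWithin S u t x + convect (u t) (u t) x = ν • (Δ (u t)) x - gradient (p t) x + f t x
  /-- Incompressibility `div u = 0` in `S × Ω` (LR16 (2.21)). -/
  divFree : ∀ t ∈ S, ∀ x ∈ Ω, VectorCalculus.divergence (u t) x = 0

/-- **Classical Navier–Stokes flows in a container with a perfect-slip wall**:
`IsClassicalNSOnDomain` together with, on `S × frontier Ω` (outer normal field `n`, an argument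
— `eR` for `unitCylinder`), the no-penetration condition `u · n = 0` and the vanishing of the
tangential viscous stress, `τ · ε(u) n = 0` for every `τ ⟂ n(x)`, where
`ε(u) = strainRateWithin (u t) (closure Ω) x` is the strain up to the wall (Lemarié-Rieusset
2016, §2.9, (2.27) "pure slip", after Solonnikov–Ščadilov 1973; Köhne 2013, (2.8)
"perfect slip" `u · ν = 0`, `P_Γ S ν = 0`, with `P_Γ S ν = 2μ P_Γ D ν`, 2.19 — the same
condition for `ν ≠ 0`). [cite: LemarieRieusset2016, §2.9 eq. (2.27)] -/
structure IsClassicalPerfectSlipNSOnDomain (S : Set ℝ) (Ω : Opens E) (n : E → E) (ν : ℝ)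
    (f u : ℝ → E → E) (p : ℝ → E → ℝ) : Prop extends IsClassicalNSOnDomain S Ω ν f u p where
  /-- No penetration `u · n = 0` on `S × ∂Ω` (Köhne (2.4)). -/
  noPenetration : ∀ t ∈ S, ∀ x ∈ frontier (Ω : Set E), ⟪u t x, n x⟫ = 0
  /-- No tangential stress: `τ · ε(u) n = 0` for tangent vectors `τ` on `S × ∂Ω` (LR16 (2.27)). -/
  perfectSlip : ∀ t ∈ S, ∀ x ∈ frontier (Ω : Set E), ∀ τ : E, ⟪τ, n x⟫ = 0 →
    ⟪strainRateWithin (u t) (closure (Ω : Set E)) x (n x), τ⟫ = 0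

/-- **Classical Navier–Stokes flows in a container with a no-slip wall**:
`IsClassicalNSOnDomain` together with `u = 0` on `S × frontier Ω` (Köhne 2013, (2.7); Lemarié-
Rieusset 2016, §2.9, "the homogeneous Dirichlet condition"; the wall condition of Hou 2022, §2).
[cite: Kohne2013, Ch. 2 eq. (2.7)] -/
structure IsClassicalNoSlipNSOnDomain (S : Set ℝ) (Ω : Opens E) (ν : ℝ) (f u : ℝ → E → E)
    (p : ℝ → E → ℝ) : Prop extends IsClassicalNSOnDomain S Ω ν f u p where
  /-- No slip `u = 0` on `S × ∂Ω` (Köhne (2.7)). -/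
  noSlip : ∀ t ∈ S, ∀ x ∈ frontier (Ω : Set E), u t x = 0

variable {S S' : Set ℝ} {Ω : Opens E} {n : E → E} {ν : ℝ} {f u : ℝ → E → E} {p : ℝ → E → ℝ}

/-- **Restriction of the time set**: a solution on `S` is a solution on every `S' ⊆ S` of
unique differentiability (`Icc`, `Ico`, open sets, …); the one-sided time derivative within `S'`
agrees with the one within `S` for fields `C¹` up to the wall
(`timeDerivWithin_eq_of_subset_of_contDiffOn`). [folklore] -/
theorem IsClassicalNSOnDomain.mono (h : IsClassicalNSOnDomain S Ω ν f u p) (hS' : S' ⊆ S)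
    (hU : UniqueDiffOn ℝ S') : IsClassicalNSOnDomain S' Ω ν f u p where
  smooth_velocity := h.smooth_velocity.mono (prod_mono hS' Subset.rfl)
  smooth_pressure := h.smooth_pressure.mono (prod_mono hS' Subset.rfl)
  momentum t ht x hx := by
    rw [timeDerivWithin_eq_of_subset_of_contDiffOn h.smooth_velocity (by simp) hS' hU ht
      (subset_closure hx)]
    exact h.momentum t (hS' ht) x hx
  divFree t ht := h.divFree t (hS' ht)

/-- **Time translation**: the system is autonomous, `(u(· + a), p(· + a))` solves it with force
`f(· + a)` on `(· + a)⁻¹' S` (`timeDerivWithin_comp_add_right`,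
`contDiffOn_uncurry_comp_add_right` of `Ferrari1993Continuation.lean`). [folklore] -/
theorem IsClassicalNSOnDomain.comp_add_right (h : IsClassicalNSOnDomain S Ω ν f u p) (a : ℝ) :
    IsClassicalNSOnDomain ((· + a) ⁻¹' S) Ω ν (fun t => f (t + a)) (fun t => u (t + a))
      (fun t => p (t + a)) where
  smooth_velocity := contDiffOn_uncurry_comp_add_right h.smooth_velocity a
  smooth_pressure := contDiffOn_uncurry_comp_add_right h.smooth_pressure a
  momentum t ht x hx := by
    rw [timeDerivWithin_comp_add_right]
    exact h.momentum (t + a) ht x hx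
  divFree t ht := h.divFree (t + a) ht

/-- The classes only see the force on `S × Ω`. [folklore] -/
theorem IsClassicalNSOnDomain.congr_force {g : ℝ → E → E} (h : IsClassicalNSOnDomain S Ω ν f u p)
    (hfg : ∀ t ∈ S, ∀ x ∈ Ω, f t x = g t x) : IsClassicalNSOnDomain S Ω ν g u p where
  smooth_velocity := h.smooth_velocity
  smooth_pressure := h.smooth_pressure
  momentum t ht x hx := by
    rw [← hfg t ht x hx]
    exact h.momentum t ht x hx
  divFree := h.divFree

/-- Restriction of the time set for the perfect-slip class. [folklore] -/
theorem IsClassicalPerfectSlipNSOnDomain.mono (h : IsClassicalPerfectSlipNSOnDomain S Ω n ν f u p)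
    (hS' : S' ⊆ S) (hU : UniqueDiffOn ℝ S') : IsClassicalPerfectSlipNSOnDomain S' Ω n ν f u p :=
  ⟨h.toIsClassicalNSOnDomain.mono hS' hU, fun t ht => h.noPenetration t (hS' ht),
    fun t ht => h.perfectSlip t (hS' ht)⟩

/-- Time translation for the perfect-slip class. [folklore] -/
theorem IsClassicalPerfectSlipNSOnDomain.comp_add_right
    (h : IsClassicalPerfectSlipNSOnDomain S Ω n ν f u p) (a : ℝ) :
    IsClassicalPerfectSlipNSOnDomain ((· + a) ⁻¹' S) Ω n ν (fun t => f (t + a))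
      (fun t => u (t + a)) (fun t => p (t + a)) :=
  ⟨h.toIsClassicalNSOnDomain.comp_add_right a, fun t ht => h.noPenetration (t + a) ht,
    fun t ht => h.perfectSlip (t + a) ht⟩

/-- Restriction of the time set for the no-slip class. [folklore] -/
theorem IsClassicalNoSlipNSOnDomain.mono (h : IsClassicalNoSlipNSOnDomain S Ω ν f u p)
    (hS' : S' ⊆ S) (hU : UniqueDiffOn ℝ S') : IsClassicalNoSlipNSOnDomain S' Ω ν f u p :=
  ⟨h.toIsClassicalNSOnDomain.mono hS' hU, fun t ht => h.noSlip t (hS' ht)⟩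

/-- Time translation for the no-slip class. [folklore] -/
theorem IsClassicalNoSlipNSOnDomain.comp_add_right (h : IsClassicalNoSlipNSOnDomain S Ω ν f u p)
    (a : ℝ) : IsClassicalNoSlipNSOnDomain ((· + a) ⁻¹' S) Ω ν (fun t => f (t + a))
      (fun t => u (t + a)) (fun t => p (t + a)) :=
  ⟨h.toIsClassicalNSOnDomain.comp_add_right a, fun t ht => h.noSlip (t + a) ht⟩

/-- No slip implies no penetration (for any normal field). [folklore] -/
theorem IsClassicalNoSlipNSOnDomain.noPenetration (h : IsClassicalNoSlipNSOnDomain S Ω ν f u p)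
    (n : E → E) {t : ℝ} (ht : t ∈ S) {x : E} (hx : x ∈ frontier (Ω : Set E)) :
    ⟪u t x, n x⟫ = 0 := by
  rw [h.noSlip t ht x hx, inner_zero_left]

/-- **The viscous power density on a perfect-slip wall vanishes**: `⟪ε(u) n, u⟫ = 0` on
`S × ∂Ω`, because `u` is tangential (`u · n = 0`) and `ε(u) n` has no tangential part
(Köhne 2013, 2.19: `u · S ν = P_Γ u · P_Γ S ν + (u · ν)(S ν · ν)`). [folklore] -/
theorem IsClassicalPerfectSlipNSOnDomain.inner_strainRate_normal_velocity
    (h : IsClassicalPerfectSlipNSOnDomain S Ω n ν f u p) {t : ℝ} (ht : t ∈ S) {x : E}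
    (hx : x ∈ frontier (Ω : Set E)) :
    ⟪strainRateWithin (u t) (closure (Ω : Set E)) x (n x), u t x⟫ = 0 :=
  h.perfectSlip t ht x hx (u t x) (h.noPenetration t ht x hx)

/-- **The boundary term of the energy balance vanishes under perfect slip**: the power density
`⟪S n, u⟫` of the Cauchy stress `S = 2ν ε(u) − p` on the wall is zero on `S × ∂Ω`, so the
boundary power `π = ∫_∂Ω (u · S n − (u · n) ½|u|²)` of the kinetic-energy balance
`d/dt ∫_Ω ½|u|² + 2ν ∫_Ω |ε|² = ∫_Ω f · u + π` has identically vanishing integrand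
(Köhne 2013, 2.15–2.16 and (2.13a)). [cite: Kohne2013, Ch. 2 §2.16 (2.13a)] -/
theorem IsClassicalPerfectSlipNSOnDomain.inner_cauchyStress_normal_velocity
    (h : IsClassicalPerfectSlipNSOnDomain S Ω n ν f u p) {t : ℝ} (ht : t ∈ S) {x : E}
    (hx : x ∈ frontier (Ω : Set E)) :
    ⟪(2 * ν) • strainRateWithin (u t) (closure (Ω : Set E)) x (n x) - p t x • n x, u t x⟫ = 0 := by
  rw [inner_sub_left, real_inner_smul_left, real_inner_smul_left,
    h.inner_strainRate_normal_velocity ht hx, real_inner_comm, h.noPenetration t ht x hx]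
  ring

end Domain

/-! ### The periodic cylinder `{r < 1} × ℝ/Lℤ` -/

/-- Local notation for physical space `ℝ³ = EuclideanSpace ℝ (Fin 3)`. -/
local notation "ℝ³" => EuclideanSpace ℝ (Fin 3)

/-- **Classical Navier–Stokes flows in the periodic slip cylinder** `Ω_L = {r < 1} × ℝ/Lℤ`:
fields on `ℝ³`, `C^∞` on `S × {r ≤ 1}` jointly in `(t, x)`, solving the forced Navier–Stokes
system with viscosity `ν` in `{r < 1}` on the time set `S`, with the perfect-slip wall
`u · e_r = 0`, `τ · ε(u) e_r = 0` (`τ ⟂ e_r`) on `{r = 1}` (Lemarié-Rieusset 2016, (2.27);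
Köhne 2013, (2.8)), and velocity and pressure `L`-periodic in `z` — the container of Hou 2022,
§2 (cylinder `{r ≤ 1}`, "periodic boundary condition in `z`") and of the Euler twin
`IsPeriodicCylinderEulerSolution`, with the free-slip instead of Hou's no-slip wall (that variant
is `IsNoSlipCylinderClassicalNSSolutionOn`). Initial data are a separate hypothesis `u 0 = u₀`.
[cite: LemarieRieusset2016, §2.9 eq. (2.27)] -/
structure IsSlipCylinderClassicalNSSolutionOn (L : ℝ) (S : Set ℝ) (ν : ℝ) (f u : ℝ → ℝ³ → ℝ³)
    (p : ℝ → ℝ³ → ℝ) : Prop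
    extends IsClassicalPerfectSlipNSOnDomain S unitCylinder eR ν f u p where
  /-- `L`-periodic velocity and pressure (Hou 2022, §2). -/
  periodic : ∀ t ∈ S, IsAxiallyPeriodic L (u t) ∧ IsAxiallyPeriodic L (p t)

/-- **Classical Navier–Stokes flows in the periodic no-slip cylinder** — Hou's container:
the Navier–Stokes system with viscosity `ν` in `{r < 1}` (here with a forcing `f`; `f = 0`
there), `C^∞` up to the wall jointly in `(t, x)`, the "no-slip no-flow boundary condition on the
solid boundary `r = 1`" (`u = 0` there; in Hou's variables `ψ₁(t,1,z) = 0`,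
`u^θ(t,1,z) = u^z(t,1,z) = 0`), velocity and pressure `L`-periodic in `z` (Hou 2022, §2,
period `1` there). [cite: Hou2022PotentiallySingularNS, §2 (no-slip no-flow wall, periodicity in z)] -/
structure IsNoSlipCylinderClassicalNSSolutionOn (L : ℝ) (S : Set ℝ) (ν : ℝ) (f u : ℝ → ℝ³ → ℝ³)
    (p : ℝ → ℝ³ → ℝ) : Prop extends IsClassicalNoSlipNSOnDomain S unitCylinder ν f u p where
  /-- `L`-periodic velocity and pressure (Hou 2022, §2). -/
  periodic : ∀ t ∈ S, IsAxiallyPeriodic L (u t) ∧ IsAxiallyPeriodic L (p t)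

section Cylinder

variable {L : ℝ} {S S' : Set ℝ} {ν : ℝ} {f u : ℝ → ℝ³ → ℝ³} {p : ℝ → ℝ³ → ℝ}

/-- Restriction of the time set for the slip-cylinder class. [folklore] -/
theorem IsSlipCylinderClassicalNSSolutionOn.mono (h : IsSlipCylinderClassicalNSSolutionOn L S ν f u p)
    (hS' : S' ⊆ S) (hU : UniqueDiffOn ℝ S') : IsSlipCylinderClassicalNSSolutionOn L S' ν f u p :=
  ⟨h.toIsClassicalPerfectSlipNSOnDomain.mono hS' hU, fun t ht => h.periodic t (hS' ht)⟩

/-- Time translation for the slip-cylinder class. [folklore] -/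
theorem IsSlipCylinderClassicalNSSolutionOn.comp_add_right
    (h : IsSlipCylinderClassicalNSSolutionOn L S ν f u p) (a : ℝ) :
    IsSlipCylinderClassicalNSSolutionOn L ((· + a) ⁻¹' S) ν (fun t => f (t + a))
      (fun t => u (t + a)) (fun t => p (t + a)) :=
  ⟨h.toIsClassicalPerfectSlipNSOnDomain.comp_add_right a, fun t ht => h.periodic (t + a) ht⟩

/-- Time translation on `[0, T)`: translating by `s ≥ 0` gives a solution on `[0, T − s)`. [folklore] -/
theorem IsSlipCylinderClassicalNSSolutionOn.translate_Ico {T s : ℝ}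
    (h : IsSlipCylinderClassicalNSSolutionOn L (Ico 0 T) ν f u p) (hs : 0 ≤ s) :
    IsSlipCylinderClassicalNSSolutionOn L (Ico 0 (T - s)) ν (fun t => f (t + s))
      (fun t => u (t + s)) (fun t => p (t + s)) :=
  (h.comp_add_right s).mono (fun t ht => ⟨by linarith [ht.1], by linarith [ht.2]⟩)
    (uniqueDiffOn_Ico 0 (T - s))

/-- Restriction of the time set for the no-slip-cylinder class. [folklore] -/
theorem IsNoSlipCylinderClassicalNSSolutionOn.mono
    (h : IsNoSlipCylinderClassicalNSSolutionOn L S ν f u p) (hS' : S' ⊆ S)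
    (hU : UniqueDiffOn ℝ S') : IsNoSlipCylinderClassicalNSSolutionOn L S' ν f u p :=
  ⟨h.toIsClassicalNoSlipNSOnDomain.mono hS' hU, fun t ht => h.periodic t (hS' ht)⟩

/-- Time translation for the no-slip-cylinder class. [folklore] -/
theorem IsNoSlipCylinderClassicalNSSolutionOn.comp_add_right
    (h : IsNoSlipCylinderClassicalNSSolutionOn L S ν f u p) (a : ℝ) :
    IsNoSlipCylinderClassicalNSSolutionOn L ((· + a) ⁻¹' S) ν (fun t => f (t + a))
      (fun t => u (t + a)) (fun t => p (t + a)) :=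
  ⟨h.toIsClassicalNoSlipNSOnDomain.comp_add_right a, fun t ht => h.periodic (t + a) ht⟩

/-! ### Rotation covariance of the slip cylinder -/

/-- The derivative up to the wall of the conjugated field `R_θ v R_{−θ}` on the closed cylinder
(a rotation-invariant set of unique differentiability): `D(R_θ v R_{−θ})(x) = R_θ Dv(R_{−θ}x) R_{−θ}`. [folklore] -/
theorem fderivWithin_conj_rotZ_closure_unitCylinder (v : ℝ³ → ℝ³) (θ : ℝ) {x : ℝ³}
    (hx : x ∈ closure (unitCylinder : Set ℝ³)) (a : ℝ³) :
    fderivWithin ℝ (fun y => rotZ θ (v (rotZ (-θ) y))) (closure (unitCylinder : Set ℝ³)) x a =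
      rotZ θ (fderivWithin ℝ v (closure (unitCylinder : Set ℝ³)) (rotZ (-θ) x) (rotZ (-θ) a)) := by
  set K : Set ℝ³ := closure (unitCylinder : Set ℝ³)
  set R := (rotZLIE θ).toContinuousLinearEquiv with hR
  set Ri := (rotZLIE θ).symm.toContinuousLinearEquiv with hRi
  have hK : Ri ⁻¹' K = K := by
    ext y
    exact rotZ_mem_closure_unitCylinder_iff (-θ)
  have hxK : UniqueDiffWithinAt ℝ K x := uniqueDiffOn_closure_unitCylinder x hx
  have h1 : (fun y => rotZ θ (v (rotZ (-θ) y))) = R ∘ (v ∘ Ri) := by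
    funext y; rfl
  have h2 : fderivWithin ℝ (v ∘ Ri) K x = (fderivWithin ℝ v K (Ri x)).comp (Ri : ℝ³ →L[ℝ] ℝ³) := by
    have := Ri.comp_right_fderivWithin (f := v) (s := K) (x := x) (by rw [hK]; exact hxK)
    rwa [hK] at this
  rw [h1, R.comp_fderivWithin hxK, h2]
  rfl

/-- Rotations move to the other side of the inner product as their inverses:
`⟪R_θ a, b⟫ = ⟪a, R_{−θ} b⟫`. [folklore] -/
theorem inner_rotZ_left (θ : ℝ) (a b : ℝ³) : ⟪rotZ θ a, b⟫ = ⟪a, rotZ (-θ) b⟫ := by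
  simpa only [rotZLIE_apply, rotZLIE_symm_apply] using (rotZLIE θ).inner_map_eq_flip a b

/-- `⟪a, R_θ b⟫ = ⟪R_{−θ} a, b⟫`. [folklore] -/
theorem inner_rotZ_right (θ : ℝ) (a b : ℝ³) : ⟪a, rotZ θ b⟫ = ⟪rotZ (-θ) a, b⟫ := by
  rw [real_inner_comm (rotZ θ b) a, inner_rotZ_left]
  exact real_inner_comm _ _

/-- The strain up to the wall of the conjugated field, as a bilinear form:
`⟪ε(R_θ v R_{−θ})(x) a, b⟫ = ⟪ε(v)(R_{−θ}x) R_{−θ}a, R_{−θ}b⟫`. [folklore] -/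
theorem inner_strainRateWithin_conj_rotZ (v : ℝ³ → ℝ³) (θ : ℝ) {x : ℝ³}
    (hx : x ∈ closure (unitCylinder : Set ℝ³)) (a b : ℝ³) :
    ⟪strainRateWithin (fun y => rotZ θ (v (rotZ (-θ) y))) (closure (unitCylinder : Set ℝ³)) x a, b⟫ =
      ⟪strainRateWithin v (closure (unitCylinder : Set ℝ³)) (rotZ (-θ) x) (rotZ (-θ) a),
        rotZ (-θ) b⟫ := by
  rw [inner_strainRateWithin, inner_strainRateWithin,
    fderivWithin_conj_rotZ_closure_unitCylinder v θ hx,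
    fderivWithin_conj_rotZ_closure_unitCylinder v θ hx, inner_rotZ_left θ, inner_rotZ_right θ]

/-- **Rotation covariance of the container class in the cylinder.** If `(u, p)` solves the
forced Navier–Stokes system in `{r < 1}` on a time set of unique differentiability, so does
`(R_θ u(t, R_{−θ}x), p(t, R_{−θ}x))` with force `R_θ f(t, R_{−θ}x)`: each term is covariant
pointwise (`timeDerivWithin_rotZ_conj`, `convect_conj_linearIsometryEquiv`,
`laplacian_conj_linearIsometryEquiv`, `gradient_comp_linearIsometryEquiv_symm`,
`divergence_conj_linearIsometryEquiv`; Majda–Bertozzi §1.2 Prop. 1.1 (iii) in the whole space). [folklore] -/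
theorem IsClassicalNSOnDomain.conj_rotZ_unitCylinder
    (h : IsClassicalNSOnDomain S unitCylinder ν f u p) (hS : UniqueDiffOn ℝ S) (θ : ℝ) :
    IsClassicalNSOnDomain S unitCylinder ν (fun t x => rotZ θ (f t (rotZ (-θ) x)))
      (fun t x => rotZ θ (u t (rotZ (-θ) x))) (fun t x => p t (rotZ (-θ) x)) := by
  set R := rotZLIE θ with hRdef
  have hR : ∀ y, R y = rotZ θ y := fun _ => rfl
  have hRs : ∀ y, R.symm y = rotZ (-θ) y := fun _ => rfl
  have hsu : ContDiffOn ℝ ∞ (uncurry fun t x => rotZ θ (u t (rotZ (-θ) x)))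
      (S ×ˢ closure (unitCylinder : Set ℝ³)) := by
    have h1 : (uncurry fun t x => rotZ θ (u t (rotZ (-θ) x))) =
        R.toContinuousLinearEquiv ∘ uncurry fun t x => u t (rotZ (-θ) x) := by
      funext z; rfl
    rw [h1]
    exact R.toContinuousLinearEquiv.contDiff.comp_contDiffOn
      (contDiffOn_uncurry_comp_rotZ h.smooth_velocity (-θ))
  refine ⟨hsu, contDiffOn_uncurry_comp_rotZ h.smooth_pressure (-θ), fun t ht x hx => ?_,
    fun t ht x hx => ?_⟩
  · -- momentum
    have hx' : rotZ (-θ) x ∈ unitCylinder := (rotZ_mem_unitCylinder_iff (-θ)).2 hx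
    have hm := congrArg R (h.momentum t ht (rotZ (-θ) x) hx')
    have hc := convect_conj_linearIsometryEquiv R (u t) (u t) x
    have hg := gradient_comp_linearIsometryEquiv_symm R (p t) x
    have hl := laplacian_conj_linearIsometryEquiv R (u t) x
    simp only [hR, hRs] at hc hg hl ⊢
    rw [timeDerivWithin_rotZ_conj (h.smooth_velocity.of_le (by exact_mod_cast le_top)) hS θ ht
      (subset_closure hx'), hc, hg, hl]
    show R _ + R _ = ν • R _ - R _ + R _
    rw [← map_add, hm, map_add, map_sub, LinearIsometryEquiv.map_smul]
  · -- incompressibility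
    have hx' : rotZ (-θ) x ∈ unitCylinder := (rotZ_mem_unitCylinder_iff (-θ)).2 hx
    have hd := divergence_conj_linearIsometryEquiv R (u t) x
    simp only [hR, hRs] at hd
    rw [hd]
    exact h.divFree t ht _ hx'

/-- **Rotation covariance of the slip cylinder.** If `(u, p)` is a flow of the class with force
`f` on a time set of unique differentiability, then `(R_θ u(t, R_{−θ}x), p(t, R_{−θ}x))` is a flow
of the class with force `R_θ f(t, R_{−θ}x)`: the wall `{r = 1}`, its normal `e_r`
(`eR_rotZ`) and the closed cylinder are `R_θ`-equivariant, the strain up to the wall is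
conjugated (`inner_strainRateWithin_conj_rotZ`), tangent vectors at `x` rotate to tangent vectors
at `R_{−θ}x`, and rotations commute with the axial translations (`rotZ_add_axialShift`). With a
uniqueness theorem this propagates axisymmetry of `(f, u₀)` to the solution, as in
`IsPeriodicCylinderEulerSolution.rotZ_velocity_eq`. [folklore] -/
theorem IsSlipCylinderClassicalNSSolutionOn.conj_rotZ
    (h : IsSlipCylinderClassicalNSSolutionOn L S ν f u p) (hS : UniqueDiffOn ℝ S) (θ : ℝ) :
    IsSlipCylinderClassicalNSSolutionOn L S ν (fun t x => rotZ θ (f t (rotZ (-θ) x)))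
      (fun t x => rotZ θ (u t (rotZ (-θ) x))) (fun t x => p t (rotZ (-θ) x)) := by
  refine ⟨⟨h.toIsClassicalNSOnDomain.conj_rotZ_unitCylinder hS θ, fun t ht x hx => ?_,
    fun t ht x hx τ hτ => ?_⟩, fun t ht => ⟨fun x => ?_, (h.periodic t ht).2.comp_rotZ (-θ)⟩⟩
  · -- no penetration
    have hx' : rotZ (-θ) x ∈ frontier (unitCylinder : Set ℝ³) :=
      (rotZ_mem_frontier_unitCylinder_iff (-θ)).2 hx
    have he : eR x = rotZ θ (eR (rotZ (-θ) x)) := by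
      rw [← eR_rotZ, ← rotZ_add, add_neg_cancel, rotZ_zero]
    show ⟪rotZ θ (u t (rotZ (-θ) x)), eR x⟫ = 0
    rw [he]
    exact ((rotZLIE θ).inner_map_map _ _).trans (h.noPenetration t ht _ hx')
  · -- perfect slip
    have hx' : rotZ (-θ) x ∈ frontier (unitCylinder : Set ℝ³) :=
      (rotZ_mem_frontier_unitCylinder_iff (-θ)).2 hx
    have he : rotZ (-θ) (eR x) = eR (rotZ (-θ) x) := by rw [← eR_rotZ]
    show ⟪strainRateWithin (fun y => rotZ θ (u t (rotZ (-θ) y))) _ x (eR x), τ⟫ = 0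
    rw [inner_strainRateWithin_conj_rotZ (u t) θ (frontier_subset_closure hx), he]
    refine h.perfectSlip t ht _ hx' _ ?_
    rw [← he]
    exact ((rotZLIE (-θ)).inner_map_map _ _).trans hτ
  · -- periodicity of the velocity
    simp only [rotZ_add_axialShift, (h.periodic t ht).1 (rotZ (-θ) x)]

/-- For axisymmetric data the conjugated flow has the same force: if every `f t` is
axisymmetric, `R_θ f(t, R_{−θ} x) = f(t, x)`. [folklore] -/
theorem IsSlipCylinderClassicalNSSolutionOn.conj_rotZ_of_isAxisymmetric_force
    (h : IsSlipCylinderClassicalNSSolutionOn L S ν f u p) (hS : UniqueDiffOn ℝ S)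
    (hf : ∀ t, IsAxisymmetric (f t)) (θ : ℝ) :
    IsSlipCylinderClassicalNSSolutionOn L S ν f (fun t x => rotZ θ (u t (rotZ (-θ) x)))
      (fun t x => p t (rotZ (-θ) x)) := by
  have hff : (fun t x => rotZ θ (f t (rotZ (-θ) x))) = f := by
    funext t x
    exact (hf t).rotZ_apply_rotZ_neg θ x
  simpa only [hff] using h.conj_rotZ hS θ

end Cylinder

end Literature.Analysis.FluidPDE
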